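import Mathlib
import HarnessLib
import Summits.QuantumFields.YangMills.Theses.PencilRigidity
import Summits.QuantumFields.YangMills.Theorems.PencilRigidityCurvatureKernelBoundKernelPinning
import Summits.QuantumFields.YangMills.Theorems.PencilRigidityCurvatureKernelBoundTensorRegularity
import Summits.QuantumFields.YangMills.Theorems.PencilRigidityCurvatureKernelBoundKernelOffDiagonalPatch
import Summits.QuantumFields.YangMills.Theorems.PencilRigidityCurvatureKernelBoundOffDiagonalExtension
import Literature.MathematicalPhysics.QuantumLattice.SchwartzReIm

/-!
# `CurvatureKernelBound` — stub S1 `OffDiagonalVanishing`: real off-diagonal tensors determine `T` on `⁰𝒮₂`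

Crux `stmt-QuantumFields-11687` (`PencilRigidity.CurvatureKernelBound`), line
`sixteen-charts-analytic-kernel`, stub `OffDiagonalVanishing` (S1, pure analysis on `(ℝ⁴)²`).

A continuous linear functional `T` on `𝓢((ℝ⁴)², ℂ)` which vanishes on every REAL off-diagonal
tensor `f₀ ⊗ f₁` (`f₀ f₁ ≡ 0`) vanishes on all of `⁰𝒮₂` (test functions flat on the diagonal).
Assembly, from the landed machinery of the line:

* `apply_eq_zero_of_isTensorOf_of_disjoint` — complex separated tensors: expand `f ⊗ g` into the
  four real tensors of `re f, im f, re g, im g` (`eq_sum_tensorFin_reIm`), each off-diagonal;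
* `kernel_eq_zero_on_box` — two-variable bump pinning: a kernel continuous on a box
  `B(c₀, r) × B(c₁, r)` whose integrals against all real bump tensors supported in the box vanish is
  zero on the box;
* `exists_nhds_apply_eq_zero` — near every off-diagonal configuration `T` is integration against a
  continuous local kernel (`TensorRegularity`, whose tensor-derivative hypotheses hold trivially since
  `T` kills separated tensors), and that kernel vanishes by pinning; so `T F = 0` for `F` supported
  in a small box;
* `OffDiagonalVanishing` — patch the boxes (`LocalKernelPatching` with the zero kernel) to get
  `T F = 0` for compactly supported `F` off the diagonal, then extend to `⁰𝒮₂`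
  (`OffDiagonalExtension` with the zero kernel).
[OsterwalderSchrader1973 §2; folklore]
-/

noncomputable section

open scoped SchwartzMap Topology
open MeasureTheory Filter Set Metric
open Literature.MathematicalPhysics.QuantumLattice Literature.MathematicalPhysics.AQFT

namespace Summit.QuantumFields.YangMills.Theorems.CurvatureKernel

/-! ## Complex separated tensors -/

/-- The complexified real or imaginary part of a test function is supported inside its support.
[folklore] -/
theorem tsupport_ofRealTest_reIm_subset {X : Type*} [NormedAddCommGroup X] [NormedSpace ℝ X]
    (φ : 𝓢(X, ℂ)) (p : Prop) [Decidable p] :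
    tsupport ((ofRealTest (if p then reTest φ else imTest φ) : 𝓢(X, ℂ)) : X → ℂ) ⊆
      tsupport (φ : X → ℂ) := by
  refine (tsupport_comp_subset (g := fun r : ℝ => (r : ℂ)) Complex.ofReal_zero _).trans ?_
  split_ifs
  · exact tsupport_reTest_subset φ
  · exact tsupport_imTest_subset φ

/-- Disjoint supports ⇒ `φ₀ ⊗ φ₁ ∈ ⁰𝒮` (family form of `isOffDiagonal_tensorFin_two`). [folklore] -/
theorem isOffDiagonal_tensorFin_two_pi {φ : Fin 2 → 𝓢((EuclideanSpace ℝ (Fin 4)), ℂ)}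
    (h : Disjoint (tsupport (φ 0 : (EuclideanSpace ℝ (Fin 4)) → ℂ)) (tsupport (φ 1 : (EuclideanSpace ℝ (Fin 4)) → ℂ))) :
    IsOffDiagonal (SchwartzMap.tensorFin 2 φ) := by
  have hφ : φ = ![φ 0, φ 1] := by
    funext i
    fin_cases i <;> rfl
  rw [hφ]
  exact isOffDiagonal_tensorFin_two h

/-- **Complex separated tensors.** A continuous functional vanishing on all real off-diagonal
tensors vanishes on every tensor `f ⊗ g` of COMPLEX test functions with disjoint supports: expand
`f ⊗ g = Σ_t i^{2-|t|} ψᵗ₀ ⊗ ψᵗ₁` with `ψᵗᵢ ∈ {re, im}` of the factors (`eq_sum_tensorFin_reIm`);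
each real tensor has separated supports, hence lies in `⁰𝒮`. [folklore] -/
theorem apply_eq_zero_of_isTensorOf_of_disjoint
    (T : 𝓢((Fin 2 → (EuclideanSpace ℝ (Fin 4))), ℂ) →L[ℂ] ℂ)
    (hT : ∀ (f : Fin 2 → 𝓢((EuclideanSpace ℝ (Fin 4)), ℝ)) (F : 𝓢((Fin 2 → (EuclideanSpace ℝ (Fin 4))), ℂ)),
      IsTensorOf F (fun i => ofRealTest (f i)) → IsOffDiagonal F → T F = 0)
    {f g : 𝓢((EuclideanSpace ℝ (Fin 4)), ℂ)}
    (hfg : Disjoint (tsupport (f : (EuclideanSpace ℝ (Fin 4)) → ℂ)) (tsupport (g : (EuclideanSpace ℝ (Fin 4)) → ℂ)))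
    {F : 𝓢((Fin 2 → (EuclideanSpace ℝ (Fin 4))), ℂ)} (hF : IsTensorOf F ![f, g]) : T F = 0 := by
  rw [eq_sum_tensorFin_reIm _ F hF, map_sum]
  refine Finset.sum_eq_zero fun t _ => ?_
  rw [map_smul, smul_eq_zero]
  refine Or.inr (hT _ _ (isTensorOf_tensorFin _) (isOffDiagonal_tensorFin_two_pi ?_))
  exact hfg.mono (tsupport_ofRealTest_reIm_subset (![f, g] 0) _)
    (tsupport_ofRealTest_reIm_subset (![f, g] 1) _)

/-! ## Two-variable bump pinning -/

/-- **Pinning on a box.** A kernel `k`, continuous on the box `{x | x₀ ∈ B(c₀, r), x₁ ∈ B(c₁, r)}`,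
whose integrals `∫ k (φ ⊗ ψ)` against all real tensors of test functions supported in `B(c₀, r)`,
`B(c₁, r)` vanish, is zero on the box: at a point `w` with `k w ≠ 0`, normalised bumps `φ ⊗ ψ ≥ 0`
concentrated where `‖k - k w‖ ≤ ‖k w‖ / 2` give `‖k w‖ ∫ φ ⊗ ψ ≤ (‖k w‖ / 2) ∫ φ ⊗ ψ` with
`∫ φ ⊗ ψ > 0`. (Two-variable form of `kernel_eq_zero_of_realTensor`.) [folklore] -/
theorem kernel_eq_zero_on_box {k : (Fin 2 → (EuclideanSpace ℝ (Fin 4))) → ℂ} {c₀ c₁ : (EuclideanSpace ℝ (Fin 4))} {r : ℝ}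
    (hk : ContinuousOn k {x | x 0 ∈ ball c₀ r ∧ x 1 ∈ ball c₁ r})
    (h0 : ∀ φ ψ : 𝓢((EuclideanSpace ℝ (Fin 4)), ℝ), tsupport (φ : (EuclideanSpace ℝ (Fin 4)) → ℝ) ⊆ ball c₀ r →
      tsupport (ψ : (EuclideanSpace ℝ (Fin 4)) → ℝ) ⊆ ball c₁ r →
      Integrable (fun x => k x * SchwartzMap.tensorFin 2 ![ofRealTest φ, ofRealTest ψ] x) ∧
        ∫ x, k x * SchwartzMap.tensorFin 2 ![ofRealTest φ, ofRealTest ψ] x = 0) :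
    ∀ w : Fin 2 → (EuclideanSpace ℝ (Fin 4)), w 0 ∈ ball c₀ r → w 1 ∈ ball c₁ r → k w = 0 := by
  intro w hw0 hw1
  by_contra hne
  set κ : ℂ := k w with hκdef
  have hκ : 0 < ‖κ‖ := norm_pos_iff.2 hne
  have hWopen : IsOpen {x : Fin 2 → (EuclideanSpace ℝ (Fin 4)) | x 0 ∈ ball c₀ r ∧ x 1 ∈ ball c₁ r} :=
    ((isOpen_ball (x := c₀) (ε := r)).preimage
      (continuous_apply 0 : Continuous fun x : Fin 2 → (EuclideanSpace ℝ (Fin 4)) => x 0)).and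
      ((isOpen_ball (x := c₁) (ε := r)).preimage
        (continuous_apply 1 : Continuous fun x : Fin 2 → (EuclideanSpace ℝ (Fin 4)) => x 1))
  have hcont : ContinuousAt k w := hk.continuousAt (hWopen.mem_nhds ⟨hw0, hw1⟩)
  obtain ⟨δ, hδ, hδk⟩ := Metric.continuousAt_iff.1 hcont (‖κ‖ / 2) (half_pos hκ)
  -- room inside the balls and inside the `δ`-neighbourhood
  have hr0 : 0 < r - dist (w 0) c₀ := sub_pos.2 (mem_ball.1 hw0)
  have hr1 : 0 < r - dist (w 1) c₁ := sub_pos.2 (mem_ball.1 hw1)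
  set s : ℝ := min (δ / 2) (min ((r - dist (w 0) c₀) / 2) ((r - dist (w 1) c₁) / 2)) with hsdef
  have hs : 0 < s := lt_min (half_pos hδ) (lt_min (half_pos hr0) (half_pos hr1))
  have hsδ : s ≤ δ / 2 := min_le_left _ _
  have hs0 : s ≤ (r - dist (w 0) c₀) / 2 := (min_le_right _ _).trans (min_le_left _ _)
  have hs1 : s ≤ (r - dist (w 1) c₁) / 2 := (min_le_right _ _).trans (min_le_right _ _)
  -- the bumps
  let φ : ContDiffBump (w 0) := ⟨s / 2, s, half_pos hs, half_lt_self hs⟩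
  let ψ : ContDiffBump (w 1) := ⟨s / 2, s, half_pos hs, half_lt_self hs⟩
  let φS : 𝓢((EuclideanSpace ℝ (Fin 4)), ℝ) := φ.hasCompactSupport.toSchwartzMap φ.contDiff
  let ψS : 𝓢((EuclideanSpace ℝ (Fin 4)), ℝ) := ψ.hasCompactSupport.toSchwartzMap ψ.contDiff
  have φS_apply : ∀ x, φS x = φ x := fun _ => rfl
  have ψS_apply : ∀ x, ψS x = ψ x := fun _ => rfl
  have htφ : tsupport (φS : (EuclideanSpace ℝ (Fin 4)) → ℝ) ⊆ ball c₀ r := by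
    rw [show ((φS : 𝓢((EuclideanSpace ℝ (Fin 4)), ℝ)) : (EuclideanSpace ℝ (Fin 4)) → ℝ) = φ from rfl, φ.tsupport_eq]
    exact closedBall_subset_ball' (by change s + dist (w 0) c₀ < r; linarith)
  have htψ : tsupport (ψS : (EuclideanSpace ℝ (Fin 4)) → ℝ) ⊆ ball c₁ r := by
    rw [show ((ψS : 𝓢((EuclideanSpace ℝ (Fin 4)), ℝ)) : (EuclideanSpace ℝ (Fin 4)) → ℝ) = ψ from rfl, ψ.tsupport_eq]
    exact closedBall_subset_ball' (by change s + dist (w 1) c₁ < r; linarith)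
  obtain ⟨hint, hI⟩ := h0 φS ψS htφ htψ
  -- the real profile `p = φ ⊗ ψ`
  set p : (Fin 2 → (EuclideanSpace ℝ (Fin 4))) → ℝ := fun x => φ (x 0) * ψ (x 1) with hp
  have hF : ∀ x, SchwartzMap.tensorFin 2 ![ofRealTest φS, ofRealTest ψS] x = ((p x : ℝ) : ℂ) := by
    intro x
    rw [tensorFin_two_apply, ofRealTest_apply, ofRealTest_apply, φS_apply, ψS_apply]
    simp only [hp, Complex.ofReal_mul]
  simp_rw [hF] at hint hI
  have hp_nonneg : ∀ x, 0 ≤ p x := fun x => mul_nonneg φ.nonneg ψ.nonneg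
  have hp_cont : Continuous p :=
    (φ.continuous.comp (continuous_apply 0)).mul (ψ.continuous.comp (continuous_apply 1))
  have hp_supp : HasCompactSupport p := by
    let B : Fin 2 → Set (EuclideanSpace ℝ (Fin 4)) := ![closedBall (w 0) s, closedBall (w 1) s]
    refine HasCompactSupport.intro (K := Set.pi Set.univ B) (isCompact_univ_pi fun i => ?_) ?_
    · fin_cases i <;> exact isCompact_closedBall _ _
    · intro x hx
      rw [Set.mem_univ_pi, Fin.forall_fin_two] at hx
      by_contra hpx
      obtain ⟨h1, h2⟩ := mul_ne_zero_iff.1 hpx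
      have h1' : x 0 ∈ Function.support φ := h1
      have h2' : x 1 ∈ Function.support ψ := h2
      rw [ContDiffBump.support_eq] at h1' h2'
      exact hx ⟨ball_subset_closedBall h1', ball_subset_closedBall h2'⟩
  have hp_w : p w ≠ 0 := by
    have h1 : φ (w 0) = 1 := φ.one_of_mem_closedBall (mem_closedBall_self (half_pos hs).le)
    have h2 : ψ (w 1) = 1 := ψ.one_of_mem_closedBall (mem_closedBall_self (half_pos hs).le)
    simp [hp, h1, h2]
  have hpos : 0 < ∫ x, p x :=
    hp_cont.integral_pos_of_hasCompactSupport_nonneg_nonzero hp_supp hp_nonneg hp_w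
  have hpi : Integrable p := hp_cont.integrable_of_hasCompactSupport hp_supp
  -- pointwise closeness on the support of `p`
  have hclose : ∀ x, ‖(κ - k x) * (p x : ℂ)‖ ≤ ‖κ‖ / 2 * p x := by
    intro x
    by_cases hx : p x = 0
    · simp [hx]
    obtain ⟨hφx, hψx⟩ := mul_ne_zero_iff.1 hx
    have h0' : x 0 ∈ ball (w 0) s := by
      have : x 0 ∈ Function.support φ := hφx
      rwa [ContDiffBump.support_eq] at this
    have h1' : x 1 ∈ ball (w 1) s := by
      have : x 1 ∈ Function.support ψ := hψx
      rwa [ContDiffBump.support_eq] at this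
    have hd : dist x w < δ := by
      rw [dist_pi_lt_iff hδ]
      intro i
      fin_cases i
      · exact lt_of_lt_of_le (mem_ball.1 h0') (by linarith)
      · exact lt_of_lt_of_le (mem_ball.1 h1') (by linarith)
    have hkx := hδk hd
    rw [dist_eq_norm] at hkx
    rw [norm_mul, Complex.norm_real, Real.norm_of_nonneg (hp_nonneg x), norm_sub_rev]
    exact mul_le_mul_of_nonneg_right hkx.le (hp_nonneg x)
  -- integrate
  have hκp : Integrable fun x => κ * (p x : ℂ) := hpi.ofReal.const_mul κ
  have hsub : Integrable fun x => (κ - k x) * (p x : ℂ) := by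
    have : (fun x => (κ - k x) * (p x : ℂ)) = fun x => κ * (p x : ℂ) - k x * (p x : ℂ) := by
      funext x; ring
    rw [this]
    exact hκp.sub hint
  have hdiff : ∫ x, (κ - k x) * (p x : ℂ) = κ * ((∫ x, p x : ℝ) : ℂ) := by
    have : (fun x => (κ - k x) * (p x : ℂ)) = fun x => κ * (p x : ℂ) - k x * (p x : ℂ) := by
      funext x; ring
    rw [this, integral_sub hκp hint, hI, sub_zero, integral_const_mul, integral_complex_ofReal]
  have hle : ‖κ‖ * ∫ x, p x ≤ ‖κ‖ / 2 * ∫ x, p x := by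
    calc ‖κ‖ * ∫ x, p x = ‖∫ x, (κ - k x) * (p x : ℂ)‖ := by
          rw [hdiff, norm_mul, Complex.norm_real, Real.norm_of_nonneg (integral_nonneg hp_nonneg)]
      _ ≤ ∫ x, ‖(κ - k x) * (p x : ℂ)‖ := norm_integral_le_integral_norm _
      _ ≤ ∫ x, ‖κ‖ / 2 * p x := integral_mono hsub.norm (hpi.const_mul _) hclose
      _ = ‖κ‖ / 2 * ∫ x, p x := integral_const_mul _ _
  have hprod : 0 < ‖κ‖ * ∫ x, p x := mul_pos hκ hpos
  linarith

/-! ## Local vanishing near an off-diagonal configuration -/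

/-- **Local vanishing.** If `T` kills every tensor `f ⊗ g` of complex test functions with disjoint
supports, then every configuration `z` with `z₀ ≠ z₁` has an open box neighbourhood `O`, off the
diagonal, such that `T F = 0` whenever `supp F ⊆ O`: `TensorRegularity` (order `M₀ = 0`, standard
frame, `U, V` = separated balls about `z₀, z₁`; its tensor-derivative hypotheses hold since the
derived tensors are still separated, so `T` vanishes on them) represents `T` on a box by a
continuous kernel, which is zero by `kernel_eq_zero_on_box`. [folklore] -/
theorem exists_nhds_apply_eq_zero (T : 𝓢((Fin 2 → (EuclideanSpace ℝ (Fin 4))), ℂ) →L[ℂ] ℂ)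
    (hT0 : ∀ f g : 𝓢((EuclideanSpace ℝ (Fin 4)), ℂ),
      Disjoint (tsupport (f : (EuclideanSpace ℝ (Fin 4)) → ℂ)) (tsupport (g : (EuclideanSpace ℝ (Fin 4)) → ℂ)) →
      ∀ F : 𝓢((Fin 2 → (EuclideanSpace ℝ (Fin 4))), ℂ), IsTensorOf F ![f, g] → T F = 0)
    (z : Fin 2 → (EuclideanSpace ℝ (Fin 4))) (hz : z 0 ≠ z 1) :
    ∃ O : Set (Fin 2 → (EuclideanSpace ℝ (Fin 4))), IsOpen O ∧ z ∈ O ∧ O ⊆ {x | x 0 ≠ x 1} ∧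
      ∀ F : 𝓢((Fin 2 → (EuclideanSpace ℝ (Fin 4))), ℂ),
        tsupport (F : (Fin 2 → (EuclideanSpace ℝ (Fin 4))) → ℂ) ⊆ O → T F = 0 := by
  -- separated balls about `z 0`, `z 1`
  have hd : 0 < dist (z 0) (z 1) := dist_pos.2 hz
  set ρ₀ : ℝ := dist (z 0) (z 1) / 3 with hρ₀def
  have hρ₀ : 0 < ρ₀ := by positivity
  have hUV : Disjoint (ball (z 0) ρ₀) (ball (z 1) ρ₀) :=
    ball_disjoint_ball (by rw [hρ₀def]; linarith)
  -- a local kernel from `TensorRegularity` (standard frame, order `0`)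
  obtain ⟨N₁, ρ, B, hρ, hreg⟩ := TensorRegularity _ (EuclideanSpace.basisFun (Fin 4) ℝ).orthonormal.linearIndependent
    (ball (z 0) ρ₀) (ball (z 1) ρ₀) isOpen_ball isOpen_ball (z 0) (z 1) (mem_ball_self hρ₀) (mem_ball_self hρ₀) 0
  obtain ⟨K₂, hK₂c, -, hK₂rep⟩ := hreg T (by
    intro j N _ f g hf hg F hF
    have h0 : T F = 0 := by
      rcases hF with hF | hF
      · exact hT0 _ _ (hUV.mono ((tsupport_iterate_lineDerivOp_subset _ N f).trans hf) hg) F hF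
      · exact hT0 _ _ (hUV.mono hf ((tsupport_iterate_lineDerivOp_subset _ N g).trans hg)) F hF
    rw [h0, norm_zero]
    exact mul_nonneg (schwartzNorm_nonneg _ _) (schwartzNorm_nonneg _ _))
  -- the small box
  set ρ' : ℝ := min ρ ρ₀ with hρ'def
  have hρ' : 0 < ρ' := lt_min hρ hρ₀
  set O : Set (Fin 2 → (EuclideanSpace ℝ (Fin 4))) := {x | x 0 ∈ ball (z 0) ρ' ∧ x 1 ∈ ball (z 1) ρ'} with hOdef
  have hOW : O ⊆ {x | x 0 ∈ ball (z 0) ρ ∧ x 1 ∈ ball (z 1) ρ} := fun x hx =>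
    ⟨ball_subset_ball (min_le_left _ _) hx.1, ball_subset_ball (min_le_left _ _) hx.2⟩
  have hO0 : O ⊆ {x | x 0 ∈ ball (z 0) ρ₀ ∧ x 1 ∈ ball (z 1) ρ₀} := fun x hx =>
    ⟨ball_subset_ball (min_le_right _ _) hx.1, ball_subset_ball (min_le_right _ _) hx.2⟩
  have hOopen : IsOpen O :=
    ((isOpen_ball (x := z 0) (ε := ρ')).preimage
      (continuous_apply 0 : Continuous fun x : Fin 2 → (EuclideanSpace ℝ (Fin 4)) => x 0)).and
      ((isOpen_ball (x := z 1) (ε := ρ')).preimage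
        (continuous_apply 1 : Continuous fun x : Fin 2 → (EuclideanSpace ℝ (Fin 4)) => x 1))
  -- the local kernel vanishes on the small box
  have hK₂0 : ∀ w : Fin 2 → (EuclideanSpace ℝ (Fin 4)), w 0 ∈ ball (z 0) ρ' → w 1 ∈ ball (z 1) ρ' → K₂ w = 0 := by
    refine kernel_eq_zero_on_box (hK₂c.mono hOW) fun φ ψ hφ hψ => ?_
    have htφ : tsupport (ofRealTest φ : (EuclideanSpace ℝ (Fin 4)) → ℂ) ⊆ ball (z 0) ρ' :=
      (tsupport_comp_subset (g := fun r : ℝ => (r : ℂ)) Complex.ofReal_zero _).trans hφ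
    have htψ : tsupport (ofRealTest ψ : (EuclideanSpace ℝ (Fin 4)) → ℂ) ⊆ ball (z 1) ρ' :=
      (tsupport_comp_subset (g := fun r : ℝ => (r : ℂ)) Complex.ofReal_zero _).trans hψ
    have hsuppF : tsupport (SchwartzMap.tensorFin 2 ![ofRealTest φ, ofRealTest ψ] :
        (Fin 2 → (EuclideanSpace ℝ (Fin 4))) → ℂ) ⊆ O :=
      (tsupport_tensorFin_two_subset_prod _ _).trans fun x hx => ⟨htφ hx.1, htψ hx.2⟩
    obtain ⟨hint, hrep⟩ := hK₂rep _ (hsuppF.trans hOW)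
    refine ⟨hint, ?_⟩
    rw [← hrep]
    exact hT0 _ _ (hUV.mono (htφ.trans (ball_subset_ball (min_le_right _ _)))
      (htψ.trans (ball_subset_ball (min_le_right _ _)))) _ (isTensorOf_tensorFin _)
  refine ⟨O, hOopen, ⟨mem_ball_self hρ', mem_ball_self hρ'⟩, fun x hx h01 => ?_, fun F hF => ?_⟩
  · exact Set.disjoint_left.1 hUV (hO0 hx).1 (h01 ▸ (hO0 hx).2)
  · obtain ⟨-, hrep⟩ := hK₂rep F (hF.trans hOW)
    rw [hrep]
    refine integral_eq_zero_of_ae (Eventually.of_forall fun x => ?_)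
    by_cases hx : x ∈ O
    · simp [hK₂0 x hx.1 hx.2]
    · simp [image_eq_zero_of_notMem_tsupport fun h => hx (hF h)]

/-! ## The stub -/

/-- **Stub `OffDiagonalVanishing` (S1 of line `sixteen-charts-analytic-kernel`, crux
`PencilRigidity.CurvatureKernelBound`; registered signature verbatim).** A continuous linear
functional on `𝓢((ℝ⁴)², ℂ)` which vanishes on every real off-diagonal tensor
(`IsTensorOf F (ofRealTest ∘ f)`, `IsOffDiagonal F`) vanishes on all of `⁰𝒮₂`: by
`apply_eq_zero_of_isTensorOf_of_disjoint` it kills complex separated tensors, by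
`exists_nhds_apply_eq_zero` it vanishes on test functions supported in small boxes off the
diagonal, by `LocalKernelPatching` (zero kernel, smooth partitions of unity) on all compactly
supported test functions off the diagonal, and by `OffDiagonalExtension` (zero kernel, cut-off
approximants `Φⱼ → F` in `𝓢`) on `⁰𝒮₂`. Equivalently: the lattice tie of `W₁` determines `S₁ 2` on
`⁰𝒮₂`. [OsterwalderSchrader1973 §2; folklore] -/
theorem OffDiagonalVanishing : open Literature.MathematicalPhysics.QuantumLattice Literature.MathematicalPhysics.AQFT Literature.MathematicalPhysics.QuantumFieldTheory in ∀ (T : SchwartzMap (Fin 2 → (EuclideanSpace ℝ (Fin 4))) ℂ →L[ℂ] ℂ), (∀ (f : Fin 2 → SchwartzMap (EuclideanSpace ℝ (Fin 4)) ℝ) (F : SchwartzMap (Fin 2 → (EuclideanSpace ℝ (Fin 4))) ℂ), IsTensorOf F (fun i => ofRealTest (f i)) → IsOffDiagonal F → T F = 0) → ∀ F : SchwartzMap (Fin 2 → (EuclideanSpace ℝ (Fin 4))) ℂ, IsOffDiagonal F → T F = 0 := by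
  intro T hT F hF
  have hT0 : ∀ f g : 𝓢((EuclideanSpace ℝ (Fin 4)), ℂ),
      Disjoint (tsupport (f : (EuclideanSpace ℝ (Fin 4)) → ℂ)) (tsupport (g : (EuclideanSpace ℝ (Fin 4)) → ℂ)) →
      ∀ G : 𝓢((Fin 2 → (EuclideanSpace ℝ (Fin 4))), ℂ), IsTensorOf G ![f, g] → T G = 0 :=
    fun f g hfg G hG => apply_eq_zero_of_isTensorOf_of_disjoint T hT hfg hG
  have hΩ : IsOpen {x : Fin 2 → (EuclideanSpace ℝ (Fin 4)) | x 0 ≠ x 1} :=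
    isOpen_ne_fun (continuous_apply 0) (continuous_apply 1)
  -- compactly supported test functions off the diagonal
  have hcomp : ∀ G : 𝓢((Fin 2 → (EuclideanSpace ℝ (Fin 4))), ℂ),
      HasCompactSupport (G : (Fin 2 → (EuclideanSpace ℝ (Fin 4))) → ℂ) →
      tsupport (G : (Fin 2 → (EuclideanSpace ℝ (Fin 4))) → ℂ) ⊆ {x | x 0 ≠ x 1} → T G = 0 := by
    intro G hGc hG
    have hloc : ∀ z ∈ {x : Fin 2 → (EuclideanSpace ℝ (Fin 4)) | x 0 ≠ x 1},
        ∃ O : Set (Fin 2 → (EuclideanSpace ℝ (Fin 4))), IsOpen O ∧ z ∈ O ∧ O ⊆ {x | x 0 ≠ x 1} ∧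
        ∀ F : 𝓢((Fin 2 → (EuclideanSpace ℝ (Fin 4))), ℂ),
          tsupport (F : (Fin 2 → (EuclideanSpace ℝ (Fin 4))) → ℂ) ⊆ O →
          HasCompactSupport (F : (Fin 2 → (EuclideanSpace ℝ (Fin 4))) → ℂ) →
          T F = ∫ x, (fun _ : Fin 2 → (EuclideanSpace ℝ (Fin 4)) => (0 : ℂ)) x * F x := by
      intro z hz
      obtain ⟨O, hO, hzO, hOΩ, hOT⟩ := exists_nhds_apply_eq_zero T hT0 z hz
      exact ⟨O, hO, hzO, hOΩ, fun F hF _ => by rw [hOT F hF]; simp⟩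
    have h := (LocalKernelPatching T {x | x 0 ≠ x 1} hΩ (fun _ => 0) continuousOn_const hloc G hGc hG).2
    simpa using h
  -- all of `⁰𝒮₂`
  have h := (OffDiagonalExtension T (fun _ => 0) continuousOn_const ⟨0, 0, fun x _ => by simp⟩
    (fun G hGc hG => ⟨by simp, by rw [hcomp G hGc hG]; simp⟩) F hF).2
  simpa using h

end Summit.QuantumFields.YangMills.Theorems.CurvatureKernel

end
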